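import Summits.SmoothPoincare4.SmoothPoincare4.Theorems.ConvexBisectionAcyclicBisectionExistsDualLoopSurgery
import Summits.SmoothPoincare4.SmoothPoincare4.Theorems.ConvexBisectionAcyclicBisectionExistsCrossingStdSymp
import HarnessLib

/-!
# Shadows of charted embedded page curves are primitive or zero (the repair lemma N3b′)
(wave 6, brick G7-3 = the repair lemma N3b′ proposed in place of node N3b `node_STembed` of stub
`stub_STgeo` = N3 of NF4 `stub_modelsOnFibred_of_reach`, line `modp-braid-orbits`, crux
`ConvexBisection.AcyclicBisectionExists`, item stmt-SmoothPoincare4-10508; registered sub-goal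
`helper_shadow_charted_primitive_or_zero`)

**The lemma.**  Let `a` be a page curve of `page g c` (`‖c‖ = 1`) presented by a positively
oriented smooth annulus chart `φ` (the six hypotheses of node N1a: smooth, `1`-periodic, core `a`,
page-valued, injective on `[0, 1) × (−1, 1)`, `∂ᵣφ` on the `i ∂ᵤφ` side).  Then its homology shadow
`v = shadow g a ∈ ℤ^{2g} = H₁(F_{g,1}; ℤ)` is ZERO or PRIMITIVE (`shadow_eq_zero_or_isPrimitive`);
more precisely, if `v ≠ 0` some loop `L` of the page has `stdSymp ℤ g v (shadow L) = 1`
(`exists_pageLoop_stdSymp_eq_one`, the dual curve).  Classical statement: the class of a simple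
closed curve on a surface with one boundary circle is primitive if the curve is non-separating
and zero if it separates (Farb–Margalit, *Primer*, §1.3 and Prop. 6.2).

**Proof.**  By the Picard–Lefschetz lemma `crossingNumber_eq_stdSymp` (X7-4, p157031) the
crossing number of every page loop with the chart is `stdSymp v (shadow ·)`.  (Z) If all `2g`
charted chain cycles `b j` of the page (Y4-5 `exists_charted_chain`, shadows `chainVec g j`) have
crossing number `0`, then `stdSymp v` kills the basis `chainVec` of `ℤ^{2g}` (`chainVec_basis`),
hence vanishes, and `v = 0` by non-degeneracy of `stdSymp` over `ℤ` (§1).  (P) Otherwise some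
`b j` (a smooth charted page loop) has non-zero crossing number, the dual loop `L` of G7-2
(`exists_loop_crossingNumber_eq_one_of_ne_zero`) has crossing number `1 = stdSymp v (shadow L)`,
and every common divisor of the coordinates of `v` divides `1` (§1).

**Use (report G7 §0–2).**  The attaching circles of an `IsLefschetzLink` are embedded page curves,
so — once charted — their classes are primitive or zero; with N3a (`node_STcurve`: primitive
classes are shadows of embedded page curves) in genus `g + 1` applied to `embed g v` (primitive iff
`v` is, `embed` being a split isometric injection) this re-plants old letters homologically WITHOUT
the page embedding `ι` of node N3b.  Everything is proved; no definitions, no named facts, no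
`sorry`.  References: B. Farb, D. Margalit, *A primer on mapping class groups* (2012), §1.3,
Prop. 6.2, §6.1 [FarbMargalit2012]; V. I. Arnold, S. M. Gusein-Zade, A. N. Varchenko,
*Singularities of Differentiable Maps II* (1988), §2 [AGZV1988].
-/

noncomputable section

set_option linter.dupNamespace false

open scoped Manifold ContDiff Topology Real
open Set Function Metric
open Literature.Topology.FourManifolds Literature.Topology.FourManifolds.LefschetzBase
  Literature.GroupTheory.CombinatorialGroupTheory.SignedHurwitz

namespace Summit.SmoothPoincare4.SmoothPoincare4.Theorems.AcyclicBisectionExists.ModpBraidOrbits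

/-! ## §1 Algebra of `stdSymp` over `ℤ`: non-degeneracy on the chain basis, unimodular values -/

/-- `stdSymp v f_j = v_{e_j}`: pairing with the `j`-th `f`-vector reads the `j`-th `e`-coordinate.
[folklore] -/
theorem stdSymp_single_inr {g : ℕ} (v : Fin g ⊕ Fin g → ℤ) (j : Fin g) :
    stdSymp ℤ g v (Pi.single (Sum.inr j) 1) = v (Sum.inl j) := by
  simp [stdSymp_int_apply, Pi.single_apply, Sum.inr.injEq]

/-- `stdSymp v e_j = −v_{f_j}`: pairing with the `j`-th `e`-vector reads minus the `j`-th
`f`-coordinate. [folklore] -/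
theorem stdSymp_single_inl {g : ℕ} (v : Fin g ⊕ Fin g → ℤ) (j : Fin g) :
    stdSymp ℤ g v (Pi.single (Sum.inl j) 1) = -v (Sum.inr j) := by
  simp [stdSymp_int_apply, Pi.single_apply, Sum.inl.injEq]

/-- **Non-degeneracy of `stdSymp` over `ℤ`**: a vector pairing to `0` with everything is `0`.
[folklore] -/
theorem eq_zero_of_stdSymp_eq_zero {g : ℕ} {v : Fin g ⊕ Fin g → ℤ} (h : stdSymp ℤ g v = 0) :
    v = 0 := by
  ext (j | j)
  · rw [← stdSymp_single_inr v j, h, LinearMap.zero_apply, Pi.zero_apply]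
  · have e := stdSymp_single_inl v j
    rw [h, LinearMap.zero_apply] at e
    rw [Pi.zero_apply]
    linarith

/-- **A vector pairing to `0` with the whole `A_{2g}` chain is `0`** (the chain vectors form a
basis of `ℤ^{2g}`, `chainVec_basis`). [cite: AGZV1988, §2] -/
theorem eq_zero_of_stdSymp_chainVec_eq_zero {g : ℕ} {v : Fin g ⊕ Fin g → ℤ}
    (h : ∀ i : Fin (2 * g), stdSymp ℤ g v (chainVec g i) = 0) : v = 0 := by
  obtain ⟨bV, hbV⟩ := chainVec_basis g
  refine eq_zero_of_stdSymp_eq_zero (bV.ext fun i => ?_)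
  rw [hbV, h i, LinearMap.zero_apply]

/-- **A vector with a unimodular pairing value is primitive**: every common divisor of the
coordinates of `v` divides `stdSymp v u`. [folklore] -/
theorem isPrimitive_of_stdSymp_eq_one {g : ℕ} {v : Fin g ⊕ Fin g → ℤ} (u : Fin g ⊕ Fin g → ℤ)
    (h : stdSymp ℤ g v u = 1) : IsPrimitive v := by
  intro d hd
  apply isUnit_of_dvd_one
  rw [← h, stdSymp_int_apply]
  exact Finset.dvd_sum fun i _ => dvd_sub ((hd _).mul_right _) ((hd _).mul_right _)

/-! ## §2 The repair lemma N3b′ -/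

variable {g : ℕ} {c : ℂ} {φ : ℝ × ℝ → Base g} {a : sphere (0 : EuclideanSpace ℝ (Fin 2)) 1 → Base g}

/-- **The dual curve of a charted page curve with non-zero class**: if the shadow `v` of the page
curve `a` presented by a positively oriented smooth annulus chart `φ` is non-zero, some loop `L`
of the page has `stdSymp ℤ g v (shadow L) = 1` (equivalently `crossingNumber φ L = 1`).
[cite: FarbMargalit2012, §6.1] -/
theorem exists_pageLoop_stdSymp_eq_one (hc : ‖c‖ = 1) (ha : Continuous a)
    (hφs : ContMDiff 𝓘(ℝ, ℝ × ℝ) (𝓡∂ 4) ∞ φ) (hφ1 : ∀ u r, φ (u + 1, r) = φ (u, r))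
    (hφa : ∀ u, φ (u, 0) = a (circlePt u)) (hφp : ∀ p, φ p ∈ page g c)
    (hφi : InjOn φ (Ico (0 : ℝ) 1 ×ˢ Ioo (-1 : ℝ) 1))
    (hφo : ∀ u r, r ∈ Ioo (-1 : ℝ) 1 →
      0 < inner ℝ (deriv (fun r' => (φ (u, r')).1) r) (cplxJ (deriv (fun u' => (φ (u', r)).1) u)))
    (hv : shadow g a ha ≠ 0) :
    ∃ (L : sphere (0 : EuclideanSpace ℝ (Fin 2)) 1 → Base g) (hL : Continuous L),
      (∀ θ, L θ ∈ page g c) ∧ crossingNumber φ L = 1 ∧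
      stdSymp ℤ g (shadow g a ha) (shadow g L hL) = 1 := by
  classical
  obtain ⟨b, ψ, hb, hch, hsh, -⟩ := exists_charted_chain g c hc
  have hbc : ∀ i θ, b i θ ∈ page g c := fun i => core_mem_page (hch i).2.2.1 (hch i).2.2.2.1
  -- some chain cycle has non-zero crossing number with the chart (else `v` kills the chain basis)
  obtain ⟨i, hi⟩ : ∃ i : Fin (2 * g), crossingNumber φ (b i) ≠ 0 := by
    by_contra h
    push Not at h
    refine hv (eq_zero_of_stdSymp_chainVec_eq_zero fun i => ?_)
    rw [← hsh i, ← crossingNumber_eq_stdSymp hc ha hφs hφ1 hφa hφp hφi hφo (hb i) (hbc i)]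
    exact h i
  -- its dual loop crosses the chart once
  obtain ⟨L, hL, hLc, hone⟩ := exists_loop_crossingNumber_eq_one_of_ne_zero hc hφs hφ1 hφp hφi
    hφo (hch i).1 (hch i).2.1 (hch i).2.2.1 (hch i).2.2.2.1 (hb i) hi
  refine ⟨L, hL, hLc, hone, ?_⟩
  rw [← crossingNumber_eq_stdSymp hc ha hφs hφ1 hφa hφp hφi hφo hL hLc, hone]

/-- **N3b′ — the shadow of a charted embedded page curve is zero or primitive.**  For a page
curve `a` of `page g c` presented by a positively oriented smooth annulus chart `φ` (the six
hypotheses of node N1a), `shadow g a = 0` or `IsPrimitive (shadow g a)`.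
[cite: FarbMargalit2012, Prop. 6.2] -/
theorem shadow_eq_zero_or_isPrimitive (hc : ‖c‖ = 1) (ha : Continuous a)
    (hφs : ContMDiff 𝓘(ℝ, ℝ × ℝ) (𝓡∂ 4) ∞ φ) (hφ1 : ∀ u r, φ (u + 1, r) = φ (u, r))
    (hφa : ∀ u, φ (u, 0) = a (circlePt u)) (hφp : ∀ p, φ p ∈ page g c)
    (hφi : InjOn φ (Ico (0 : ℝ) 1 ×ˢ Ioo (-1 : ℝ) 1))
    (hφo : ∀ u r, r ∈ Ioo (-1 : ℝ) 1 →
      0 < inner ℝ (deriv (fun r' => (φ (u, r')).1) r) (cplxJ (deriv (fun u' => (φ (u', r)).1) u))) :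
    shadow g a ha = 0 ∨ IsPrimitive (shadow g a ha) := by
  by_cases hv : shadow g a ha = 0
  · exact Or.inl hv
  · obtain ⟨L, hL, -, -, h1⟩ := exists_pageLoop_stdSymp_eq_one hc ha hφs hφ1 hφa hφp hφi hφo hv
    exact Or.inr (isPrimitive_of_stdSymp_eq_one _ h1)

/-! ## §3 The registered form -/

/-- **Sub-goal `helper_shadow_charted_primitive_or_zero`** (G7-3 = the repair lemma N3b′ for node
N3b of NF4): the homology shadow of a page curve of `page g c` presented by a positively oriented
smooth annulus chart (the six hypotheses of node N1a) is zero or primitive, in registered form.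
[cite: FarbMargalit2012, Prop. 6.2] -/
theorem helper_shadow_charted_primitive_or_zero : ∀ (g : ℕ) (c : ℂ) (_hc : ‖c‖ = 1) (a : Metric.sphere (0 : EuclideanSpace ℝ (Fin 2)) 1 → Literature.Topology.FourManifolds.LefschetzBase.Base g) (ha : Continuous a) (φ : ℝ × ℝ → Literature.Topology.FourManifolds.LefschetzBase.Base g) (_hφs : ContMDiff 𝓘(ℝ, ℝ × ℝ) (𝓡∂ 4) ∞ φ) (_hφ1 : ∀ u r, φ (u + 1, r) = φ (u, r)) (_hφa : ∀ u, φ (u, 0) = a (Literature.Topology.FourManifolds.circlePt u)) (_hφp : ∀ p, φ p ∈ Literature.Topology.FourManifolds.LefschetzBase.page g c) (_hφi : Set.InjOn φ (Set.Ico (0 : ℝ) 1 ×ˢ Set.Ioo (-1 : ℝ) 1)) (_hφo : ∀ u r, r ∈ Set.Ioo (-1 : ℝ) 1 → 0 < inner ℝ (deriv (fun r' => (φ (u, r')).1) r) (Literature.Topology.FourManifolds.LefschetzBase.cplxJ (deriv (fun u' => (φ (u', r)).1) u))), Literature.Topology.FourManifolds.LefschetzBase.shadow g a ha = 0 ∨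 Literature.GroupTheory.CombinatorialGroupTheory.SignedHurwitz.IsPrimitive (Literature.Topology.FourManifolds.LefschetzBase.shadow g a ha) :=
  fun _ _ hc _ ha _ hφs hφ1 hφa hφp hφi hφo =>
    shadow_eq_zero_or_isPrimitive hc ha hφs hφ1 hφa hφp hφi hφo

end Summit.SmoothPoincare4.SmoothPoincare4.Theorems.AcyclicBisectionExists.ModpBraidOrbits

end
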